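/-
Origin: expansion seat `planner-pub-hodgecm-prl2-g9-0`, handover #1 2026-08-18T17:03Z md5 296846de2974937eab87cd77bd2f13c7 (NEW additive leaf, 151 l.; imports the tree module HodgeCM.Literature.ArchThetaSignature ONLY (cf-KHR, RUN-31 install) — NO import rewrite; PKG twin of the hub-tree module Literature/RepresentationTheory/BergeronMillsonMoeglin2016/GlobalToLocalStep.lean (p176686 ACCEPTED + v3); decls in namespace HodgeCM.Literature.BMM.BMMArchSpectrum: Pro (`HOME/pub-hodgecm-prl2-g9/lean/Prl2g9/GlobalToLocalByName.lean`, md5 296846de, 151 lines);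
landed by the packager successor (mc-unitary-1-g3, gen-8 kit) in gate run 32 as `HodgeCM/Literature/GlobalToLocalByName.lean` (verbatim).
-/
/-
WIP — pub-hodgecm EXPANSION prover a-2 "REDUCE, don't construct", generation 9 (unit pub-hodgecm-prl2-g9).
Target in the package: `HodgeCM/Literature/GlobalToLocalByName.lean` (no import rewrite: imports the tree module
`HodgeCM.Literature.ArchThetaSignature` installed by RUN 31).  Package twin of the hub-tree module
`Literature/RepresentationTheory/BergeronMillsonMoeglin2016/GlobalToLocalStep.lean` (p176686 + v3).
-/
import Summits.HodgeConjecture.HodgeCM.Literature.ArchThetaSignature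

/-!
# [BMM16] Proposition 13.4, the global-to-local step of the printed proof of Thm 7.2 (a PRINTED theorem in the
# stable range: J.-S. Li, as printed in Cossutta–Marshall 2013), and the printed proof CERTIFIED — BY NAME

Over the cited-fact seat's `BMMArchSpectrum` (`HodgeCM.Literature.ArchThetaSignature`; nothing new is posited; the
package numbers [BMM16] Thm 7.2 / Cor 7.3 as `Thm78` / `Cor79` after the arXiv v3 numbering 7.8 / 7.9):
* `Prop134` — [BMM16] Proposition 13.4 verbatim (Acta Part 3 = arXiv:1306.1515v3 chunk p0055 L18–22).
* `GlobalToLocal` — the INFERENCE the printed proof of [BMM16] Thm 7.2 (Acta pp. 65–66 = arXiv chunk p0034 L38–40)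
  uses between Proposition 13.4 and A. Paul's signature sentence and does not spell out: "`π` is in the image of the
  `ψ`-theta correspondence from `U(W)`" ⟹ "`π_∞` is in the image of the LOCAL theta correspondence from
  `U(W ⊗ ℝ) = U(W, ℂ/ℝ)`", a group of signature `sig_∞(W)` — LABELLED a step of a printed proof (= compatibility of
  the global theta correspondence with the local Howe correspondence at the archimedean place; the localisation
  argument is PRINTED for orthogonal–symplectic pairs in S. Rallis, Compositio Math. 51 (1984), proof of Thm 1.2.2,
  p. 356; a theorem-level statement for general unitary dual pairs outside the stable range — C. Mœglin, J. Lie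
  Theory 7 (1997) 231–238 — is NOT held: acq-07766); `GlobalToLocalDeg` — its weakest form, the one the printed
  proof consumes.
* **`GlobalToLocalStable` — the same inference in the STABLE RANGE `2·dim W < m`, where it IS a printed theorem**:
  J.-S. Li's theorem AS PRINTED in M. Cossutta, S. Marshall, IMRN 2013 (11) 2601–2623, §2 (tree bib
  `CossuttaMarshall2012`; held arXiv:1106.2765 chunk p0007 L61–65; "[Li2]" = Li, Crelle 428 (1992), bib `Li1992`).
  PerL's pair `(U(⟨a⟩), U(V))`, `dim V = 3 > 2·1`, is in the stable range.
* KERNEL: `thm78_of_prop134 : Prop134 → GlobalToLocal → ArchSignature → Thm78` (the printed proof, certified);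
  `two_mul_add_lt_of_degreeBound_three` (at `m = 3` the degree bound forces `a+b ≤ 1`, i.e. the stable range);
  `globalToLocalDeg_of_stable`; **`thm78_of_prop134_stable : m = 3 → Prop134 → GlobalToLocalStable → ArchSignature →
  Thm78`** — at `m = 3` the printed proof of Thm 7.2 runs on PRINTED statements only.
None of these is a PerL / [QW8] / 2001-programme claim; nothing is asserted by the `Prop`-valued definitions.
-/

set_option autoImplicit false

namespace HodgeCM

/-! ## (A) [BMM16] Proposition 13.4 and the global-to-local step of the printed proof of Thm 7.2, BY NAME -/

namespace Literature.BMM.BMMArchSpectrum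

variable {X : BMMArchSpectrum}

/-- **PRINT BY NAME — [BMM16] Proposition 13.4** (Acta Part 3; arXiv:1306.1515v3 chunk p0055 L18–22, verbatim): "Let
`π ∈ 𝒜^c(U(V))` and let `v` be an infinite place of `F` such that `U(V)(F_v) ≅ U(p,q)`.  Assume that `π_v` is
(isomorphic to) the cohomological representation `A(b×q, a×q)` of `U(p,q)` with `3(a+b)+|a−b| < 2m`.  Then, there
exists some `(a+b)`-dimensional skew-Hermitian space `W` over `E` such that `π` is in the image of the cuspidal
`ψ`-theta correspondence from the group `U(W)`."  Typed for `π = A(b×q,a×q) ⊗ π_f`, `π_f ∈ Coh_f^{b,a}` (the form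
the printed proof of Thm 7.2 invokes).  Nothing is asserted. -/
def Prop134 (X : BMMArchSpectrum) : Prop :=
  ∀ (a b : ℕ) (πf : X.RepF), X.degreeBound a b → πf ∈ X.CohF b a →
    ∃ W : X.SkewHerm, X.dimW W = a + b ∧ X.IsThetaLiftFrom (X.A b a) πf W

/-- **PRINT-PROOF-STEP BY NAME — the global-to-local step of the printed proof of [BMM16] Thm 7.2** (Acta pp. 65–66;
arXiv chunk p0034 L38–40: "the theorem follows from Proposition 13.4 … The only remaining thing to be proved is that
the signature at infinity is `(a,b)`: this follows from the fact that `A(b×q,a×q)` is the image of the local theta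
correspondance from a group `U(W,ℂ/ℝ)` of dimension `a+b` if and only if the signature is `(a,b)` [Paul]"): the
inference used there — if `π = π_∞ ⊗ π_f` is a global `ψ`-theta lift from `U(W)` then `π_∞` is in the image of the
LOCAL theta correspondence from `U(W ⊗ ℝ) = U(W, ℂ/ℝ)`, a group of signature `sig_∞(W)`.  (Compatibility of the global
theta correspondence with the local Howe correspondence at the archimedean place; printed as a localisation argument
for orthogonal–symplectic pairs in [Rallis84], proof of Thm 1.2.2, p. 356.)  Nothing is asserted; never citable as a
PerL/[QW8] fact — it is a step of a PUBLISHED proof, taken by name. -/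
def GlobalToLocal (X : BMMArchSpectrum) : Prop :=
  ∀ (πinf : X.CohInf) (πf : X.RepF) (W : X.SkewHerm),
    X.IsThetaLiftFrom πinf πf W → X.IsLocalThetaLiftFrom πinf (X.sigInf W)

/-- KERNEL: the signature of the lifting group is forced — under `3(a+b)+|a−b| < 2m`, a global `ψ`-theta lift
`A(b×q,a×q) ⊗ π_f` from `U(W)` with `dim W = a+b` has `sig_∞(W) = (a,b)` (global-to-local step + Paul's sentence). -/
theorem sigInf_eq_of_isThetaLiftFrom (hG : X.GlobalToLocal) (hS : X.ArchSignature) {a b : ℕ} {πf : X.RepF}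
    {W : X.SkewHerm} (hdeg : X.degreeBound a b) (hdim : X.dimW W = a + b)
    (hW : X.IsThetaLiftFrom (X.A b a) πf W) : X.sigInf W = (a, b) := by
  have hloc : X.IsLocalThetaLiftFrom (X.A b a) ((X.sigInf W).1, (X.sigInf W).2) := hG _ _ _ hW
  exact (hS a b (X.sigInf W).1 (X.sigInf W).2 hdeg hdim).mp hloc

/-- KERNEL — **the printed proof of [BMM16] Thm 7.2 (package name `Thm78`), certified**: Proposition 13.4, the
global-to-local step and Paul's signature sentence imply it. -/
theorem thm78_of_prop134 (h134 : X.Prop134) (hG : X.GlobalToLocal) (hS : X.ArchSignature) :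
    X.toBMMSpectrum.Thm78 := by
  intro a b πf hdeg hπ
  obtain ⟨W, hdim, hW⟩ := h134 a b πf hdeg hπ
  exact ⟨W, sigInf_eq_of_isThetaLiftFrom hG hS hdeg hdim hW, hW⟩

variable (X) in
/-- **PRINT-PROOF-STEP BY NAME, weakest form** (package twin of the tree's `GlobalToLocalDeg`): the global-to-local
step restricted to what the printed proof of [BMM16] Thm 7.2 consumes — only for `π_∞ = A(b×q,a×q)`, `dim W = a+b`,
under `3(a+b)+|a−b| < 2m`.  Implied by `GlobalToLocal`; at `m = 3` implied by the PRINTED stable-range theorem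
`GlobalToLocalStable`.  Nothing is asserted. -/
def GlobalToLocalDeg : Prop :=
  ∀ (a b : ℕ) (πf : X.RepF) (W : X.SkewHerm), X.degreeBound a b → X.dimW W = a + b →
    X.IsThetaLiftFrom (X.A b a) πf W → X.IsLocalThetaLiftFrom (X.A b a) (X.sigInf W)

variable (X) in
/-- **PRINT BY NAME — J.-S. Li's stable-range theorem, AS PRINTED in [Cossutta–Marshall, IMRN 2013 (11) 2601–2623,
§2]** (tree bib `CossuttaMarshall2012`; held arXiv:1106.2765 chunk p0007 L61–65, verbatim): "In general, `θ_φ(f,h)`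
is a smooth function of moderate growth on `G(F)\G(𝔸)`.  However, if we assume in addition that
`n > 2n' + 4d − 2` then the following theorem was proven by Li in [Li2].  THEOREM. `θ_φ(f,h)` is square integrable,
and nonzero for some choice of `f ∈ π` and `φ ∈ S(X(𝔸))`.  If `Θ(π,V)` is the subspace of `L²(G(F)\G(𝔸))`
generated by the functions `θ_φ(f,h)` under the action of `G(𝔸)`, then `Θ(π,V)` is an irreducible automorphic
representation which is isomorphic to `⊗_v θ(π_v, V_v)`."  ([Li2] = J.-S. Li, J. reine angew. Math. 428 (1992)
177–217, tree bib `Li1992`, not held — acq-07570 cite-only.  Setting, chunk p0003: `F` totally real, `E/F` quadratic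
= "case 2", `d = 1/2`, so the hypothesis reads `n > 2n'`; `G = U(V)`, `n = dim V = m`; `G' = U(V')`, `n' = dim V'`;
`π` a cusp form on `G'`; `θ(π_v, V_v)` = the unique irreducible quotient of the local big theta lift, chunk p0006.)
TYPING at the distinguished archimedean place (BMM's `W` = C–M's `V'`): if `π_∞ ⊗ π_f ∈ 𝒜^c(U(V))` is in the image
of the cuspidal `ψ`-theta correspondence from `U(W)` ([BMM16] Def. 7.5: `= Θ(π')`, `π'` cuspidal on `U(W)`) with
`2·dim W < m`, then `π_∞ ≅ θ(π'_∞, V_∞)` is in the image of the LOCAL theta correspondence from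
`U(W)(F_∞) = U(W, ℂ/ℝ)`, a group of signature `sig_∞(W)`.  PerL's case `U(⟨a⟩) → U(V)`, `dim V = 3 > 2 = 2·dim ⟨a⟩`,
IS in the stable range.  Nothing is asserted. -/
def GlobalToLocalStable : Prop :=
  ∀ (πinf : X.CohInf) (πf : X.RepF) (W : X.SkewHerm), 2 * X.dimW W < X.m →
    X.IsThetaLiftFrom πinf πf W → X.IsLocalThetaLiftFrom πinf (X.sigInf W)

/-- KERNEL: the general step implies its restricted form. -/
theorem globalToLocalDeg_of_globalToLocal (hG : X.GlobalToLocal) : X.GlobalToLocalDeg :=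
  fun a b πf W _ _ hW => hG (X.A b a) πf W hW

/-- KERNEL (arithmetic): at `m = 3`, BMM's degree bound `3(a+b)+|a−b| < 2m` forces `a + b ≤ 1`, hence the stable
range `2(a+b) < m`. -/
theorem two_mul_add_lt_of_degreeBound_three (hm : X.m = 3) {a b : ℕ} (h : X.degreeBound a b) :
    2 * (a + b) < X.m := by
  have h0 : (0 : ℤ) ≤ |(a : ℤ) - b| := abs_nonneg _
  simp only [BMMSpectrum.degreeBound, hm] at h
  push_cast at h
  omega

/-- KERNEL: **at `m = 3` the PRINTED stable-range theorem supplies the global-to-local step** of the proof of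
Thm 7.2. -/
theorem globalToLocalDeg_of_stable (hm : X.m = 3) (hG : X.GlobalToLocalStable) : X.GlobalToLocalDeg := by
  intro a b πf W hdeg hdim hW
  refine hG (X.A b a) πf W ?_ hW
  rw [hdim]
  exact two_mul_add_lt_of_degreeBound_three hm hdeg

/-- KERNEL — the printed proof of [BMM16] Thm 7.2 from its WEAKEST typed inputs. -/
theorem thm78_of_prop134_deg (h134 : X.Prop134) (hG : X.GlobalToLocalDeg) (hS : X.ArchSignature) :
    X.toBMMSpectrum.Thm78 := by
  intro a b πf hdeg hπ
  obtain ⟨W, hdim, hW⟩ := h134 a b πf hdeg hπ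
  have hloc : X.IsLocalThetaLiftFrom (X.A b a) ((X.sigInf W).1, (X.sigInf W).2) := hG a b πf W hdeg hdim hW
  exact ⟨W, (hS a b (X.sigInf W).1 (X.sigInf W).2 hdeg hdim).mp hloc, hW⟩

/-- KERNEL — **[BMM16] Thm 7.2 (package `Thm78`) at `m = 3` from PRINTED statements only**: Proposition 13.4, Li's
stable-range theorem as printed in [Cossutta–Marshall 2013], Paul's signature sentence. -/
theorem thm78_of_prop134_stable (hm : X.m = 3) (h134 : X.Prop134) (hG : X.GlobalToLocalStable)
    (hS : X.ArchSignature) : X.toBMMSpectrum.Thm78 :=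
  thm78_of_prop134_deg h134 (globalToLocalDeg_of_stable hm hG) hS

end Literature.BMM.BMMArchSpectrum

end HodgeCM
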